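import Mathlib.Analysis.SpecialFunctions.Pow.Real
import HarnessLib

/-!
# `UnitScaleTiltProp7CornerFrameLegsPropagation` — LANE II (R-LEGS), brick (Br-6a): THE PURE-REAL PROPAGATION OF THE LEGS RECURSION `E_{l+1} ≤ q·E_l + s_l`, `E_0 = 0`
# — exact unrolling `E_k ≤ Σ_{j<k} q^{k−1−j}·s_j` and the GEOMETRICALLY DOMINATED form `s_l ≤ c₁ρ₁ˡ + c₂ρ₂ˡ`, `ρ_i > q` ⇒ `E_l ≤ (c₁∕(ρ₁−q))·ρ₁ˡ + (c₂∕(ρ₂−q))·ρ₂ˡ` (top-dominated, k-UNIFORM)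
# (crux `MinimiserStabilityRegPr`, stmt-QuantumFields-19200, EX lane, hN06 LANE II (QB)∕(QH1) supplier (R-LEGS); `--supports stmt-QuantumFields-19200 --as helper`, count-neutral)

Cell `ym3-torus` (HUMAN RULING D-0037: YM₃ on T³ is ladder rung R3 — NOT d = 4, NOT infinite volume, NOT a mass gap, NOT the Clay problem), width seat `ym-ust-20520-w4` (g12), pen of the
curved row `rlegs`.  THEOREMS ONLY (0 `def`, 0 `sorry`); pure real bookkeeping; nothing here claims (R-LEGS-cov), (QB), (QH1), (REC), `hN06`, EX or the crux.

WHY.  ✓(Br-5′) `Prop7CornerFrameLegsStepCell.legs_step_cell_le` is the one-step `ℓ²` legs inequality `E_{l+1} ≤ q·E_l + s_l` with `q = 4L^{2−d}` (`= 4∕L` at `d = 3`, NOT a contraction in the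
sense of ✓`Prop7TwistedLevelMassInduction.frameMass_induction`, whose `qL ≤ ½` fails) and a SOURCE `s_l` that GROWS geometrically (the single-bar tower's gradient energy `G_l ~ Lˡ·Σ‖∇A‖²` at
`d = 3`, the curvature terms `~ e²·poly(L)·L^{3l−4k}`).  The legs mechanism of record (px19 g6 07:49:25Z (2); LOCATE №2 e299e056 §1(d)) is exactly that such a recursion is dominated by its
top level whenever every source rate exceeds `q` (`L > 4∕L` for `L ≥ 3`): this file is that arithmetic, representation-free.

* `rec_unroll_le` — `E_0 ≤ 0`, `E_{l+1} ≤ q·E_l + s_l`, `q ≥ 0` ⇒ `E_k ≤ Σ_{j<k} q^{k−1−j}·s_j`.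
* ★ `rec_two_rates_le` — with `s_l ≤ c₁ρ₁ˡ + c₂ρ₂ˡ`, `c_i ≥ 0`, `ρ_i > q ≥ 0`: `E_l ≤ (c₁∕(ρ₁−q))·ρ₁ˡ + (c₂∕(ρ₂−q))·ρ₂ˡ` for every `l`.
* `rec_one_rate_le` — the one-rate case.
HONEST SCOPE.  [folklore] real sequences; rung R3; nothing of the crux ∕ the gap is claimed.

References: T. Bałaban, CMP 98 (1985) 17–51 [Balaban1985Averaging] ((97) p.32, (160)–(163) p.42).
-/

set_option autoImplicit false

namespace Summit.QuantumFields.YangMills.Theorems.Prop7CornerFrameLegsPropagation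

open Finset

/-- **EXACT UNROLLING**: `E_0 ≤ 0`, `E_{l+1} ≤ q·E_l + s_l` (`q ≥ 0`) ⇒ `E_k ≤ Σ_{j<k} q^{k−1−j}·s_j`. [folklore] -/
theorem rec_unroll_le {q : ℝ} (hq : 0 ≤ q) (E s : ℕ → ℝ) (h0 : E 0 ≤ 0) (hstep : ∀ l, E (l + 1) ≤ q * E l + s l) :
    ∀ k : ℕ, E k ≤ ∑ j ∈ range k, q ^ (k - 1 - j) * s j
  | 0 => by simpa using h0
  | k + 1 => by
    have ih := rec_unroll_le hq E s h0 hstep k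
    calc E (k + 1) ≤ q * E k + s k := hstep k
      _ ≤ q * (∑ j ∈ range k, q ^ (k - 1 - j) * s j) + s k := by
          have := mul_le_mul_of_nonneg_left ih hq; linarith
      _ = ∑ j ∈ range (k + 1), q ^ (k + 1 - 1 - j) * s j := by
          rw [Finset.sum_range_succ, Finset.mul_sum]
          congr 1
          · refine Finset.sum_congr rfl fun j hj => ?_
            rw [Finset.mem_range] at hj
            rw [← mul_assoc, ← pow_succ']
            congr 2
            omega
          · simp

/-- ★ **TWO GEOMETRIC SOURCE RATES ABOVE `q` ARE PROPAGATED WITHOUT LOSS**: `E_0 ≤ 0`, `E_{l+1} ≤ q·E_l + s_l`, `s_l ≤ c₁ρ₁ˡ + c₂ρ₂ˡ`, `0 ≤ q < ρ_i`, `0 ≤ c_i` ⇒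
`E_l ≤ (c₁∕(ρ₁ − q))·ρ₁ˡ + (c₂∕(ρ₂ − q))·ρ₂ˡ` for every `l` (the invariant survives one step since `q·(c∕(ρ−q)) + c = (c∕(ρ−q))·ρ`).  At the member: `q = 4L^{2−d}`, `ρ₁ = L` (gradient energy of the
single-bar tower), `ρ₂` the curvature rate. [cite: Balaban1985Averaging, (97) p.32, (163) p.42] -/
theorem rec_two_rates_le {q ρ₁ ρ₂ c₁ c₂ : ℝ} (hq : 0 ≤ q) (hρ₁ : q < ρ₁) (hρ₂ : q < ρ₂) (hc₁ : 0 ≤ c₁) (hc₂ : 0 ≤ c₂)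
    (E s : ℕ → ℝ) (h0 : E 0 ≤ 0) (hstep : ∀ l, E (l + 1) ≤ q * E l + s l) (hs : ∀ l, s l ≤ c₁ * ρ₁ ^ l + c₂ * ρ₂ ^ l) :
    ∀ l : ℕ, E l ≤ c₁ / (ρ₁ - q) * ρ₁ ^ l + c₂ / (ρ₂ - q) * ρ₂ ^ l
  | 0 => by
    have h1 : 0 ≤ c₁ / (ρ₁ - q) := div_nonneg hc₁ (by linarith)
    have h2 : 0 ≤ c₂ / (ρ₂ - q) := div_nonneg hc₂ (by linarith)
    simp only [pow_zero, mul_one]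
    linarith
  | l + 1 => by
    have ih := rec_two_rates_le hq hρ₁ hρ₂ hc₁ hc₂ E s h0 hstep hs l
    have hρ₁0 : 0 < ρ₁ - q := by linarith
    have hρ₂0 : 0 < ρ₂ - q := by linarith
    have hp₁ : 0 ≤ ρ₁ ^ l := pow_nonneg (by linarith) _
    have hp₂ : 0 ≤ ρ₂ ^ l := pow_nonneg (by linarith) _
    have key₁ : q * (c₁ / (ρ₁ - q) * ρ₁ ^ l) + c₁ * ρ₁ ^ l = c₁ / (ρ₁ - q) * ρ₁ ^ (l + 1) := by
      rw [pow_succ]; field_simp; ring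
    have key₂ : q * (c₂ / (ρ₂ - q) * ρ₂ ^ l) + c₂ * ρ₂ ^ l = c₂ / (ρ₂ - q) * ρ₂ ^ (l + 1) := by
      rw [pow_succ]; field_simp; ring
    calc E (l + 1) ≤ q * E l + s l := hstep l
      _ ≤ q * (c₁ / (ρ₁ - q) * ρ₁ ^ l + c₂ / (ρ₂ - q) * ρ₂ ^ l) + (c₁ * ρ₁ ^ l + c₂ * ρ₂ ^ l) := by
          have := mul_le_mul_of_nonneg_left ih hq; linarith [hs l]
      _ = c₁ / (ρ₁ - q) * ρ₁ ^ (l + 1) + c₂ / (ρ₂ - q) * ρ₂ ^ (l + 1) := by rw [← key₁, ← key₂]; ring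

/-- The one-rate case: `s_l ≤ c·ρˡ`, `0 ≤ q < ρ`, `0 ≤ c` ⇒ `E_l ≤ (c∕(ρ − q))·ρˡ`. [cite: Balaban1985Averaging, (97) p.32, (163) p.42] -/
theorem rec_one_rate_le {q ρ c : ℝ} (hq : 0 ≤ q) (hρ : q < ρ) (hc : 0 ≤ c)
    (E s : ℕ → ℝ) (h0 : E 0 ≤ 0) (hstep : ∀ l, E (l + 1) ≤ q * E l + s l) (hs : ∀ l, s l ≤ c * ρ ^ l) :
    ∀ l : ℕ, E l ≤ c / (ρ - q) * ρ ^ l := by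
  intro l
  have h := rec_two_rates_le hq hρ hρ hc le_rfl E s h0 hstep (fun l => by have := hs l; linarith) l
  simpa using h

/-! ## §2 (append, w4-20520 g12) Finitely many geometric source rates above `q` -/

/-- ★★ **FINITELY MANY GEOMETRIC SOURCE RATES ABOVE `q` ARE PROPAGATED WITHOUT LOSS**: `E_0 ≤ 0`, `E_{l+1} ≤ q·E_l + Σ_i c_i·ρ_iˡ` over a finite index type, `0 ≤ q < ρ_i`,
`0 ≤ c_i` ⇒ `E_l ≤ Σ_i (c_i∕(ρ_i − q))·ρ_iˡ` for every `l` (the member's (R-LEGS-cov) recursion has the four rates `L, L³, L⁵, L⁷` against `q = 4∕L`: the gradient energy, the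
`e²`-mass and `e²`-gradient curvature slots and their product). [cite: Balaban1985Averaging, (97) p.32, (163) p.42] -/
theorem rec_rates_le {ι : Type*} [Fintype ι] {q : ℝ} (hq : 0 ≤ q) (ρ c : ι → ℝ) (hρ : ∀ i, q < ρ i) (hc : ∀ i, 0 ≤ c i)
    (E : ℕ → ℝ) (h0 : E 0 ≤ 0) (hstep : ∀ l, E (l + 1) ≤ q * E l + ∑ i, c i * ρ i ^ l) :
    ∀ l : ℕ, E l ≤ ∑ i, c i / (ρ i - q) * ρ i ^ l
  | 0 => by
    refine h0.trans (Finset.sum_nonneg fun i _ => ?_)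
    have : 0 ≤ c i / (ρ i - q) := div_nonneg (hc i) (by linarith [hρ i])
    simpa using this
  | l + 1 => by
    have ih := rec_rates_le hq ρ c hρ hc E h0 hstep l
    have key : ∀ i, q * (c i / (ρ i - q) * ρ i ^ l) + c i * ρ i ^ l = c i / (ρ i - q) * ρ i ^ (l + 1) := by
      intro i
      have hρq : 0 < ρ i - q := by linarith [hρ i]
      rw [pow_succ]; field_simp; ring
    calc E (l + 1) ≤ q * E l + ∑ i, c i * ρ i ^ l := hstep l
      _ ≤ q * (∑ i, c i / (ρ i - q) * ρ i ^ l) + ∑ i, c i * ρ i ^ l := by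
          have := mul_le_mul_of_nonneg_left ih hq; linarith
      _ = ∑ i, c i / (ρ i - q) * ρ i ^ (l + 1) := by
          rw [Finset.mul_sum, ← Finset.sum_add_distrib]
          exact Finset.sum_congr rfl fun i _ => key i

/-- The same with the sources only BOUNDED by the geometric family: `s_l ≤ Σ_i c_i ρ_iˡ`. [cite: Balaban1985Averaging, (97) p.32, (163) p.42] -/
theorem rec_rates_le_of_le {ι : Type*} [Fintype ι] {q : ℝ} (hq : 0 ≤ q) (ρ c : ι → ℝ) (hρ : ∀ i, q < ρ i) (hc : ∀ i, 0 ≤ c i)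
    (E s : ℕ → ℝ) (h0 : E 0 ≤ 0) (hstep : ∀ l, E (l + 1) ≤ q * E l + s l) (hs : ∀ l, s l ≤ ∑ i, c i * ρ i ^ l) :
    ∀ l : ℕ, E l ≤ ∑ i, c i / (ρ i - q) * ρ i ^ l :=
  rec_rates_le hq ρ c hρ hc E h0 fun l => (hstep l).trans (by linarith [hs l])

end Summit.QuantumFields.YangMills.Theorems.Prop7CornerFrameLegsPropagation
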